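import Literature.Probability.RandomPlanarGeometry.SLERestrictionMartingaleExistsKappa
import Literature.Probability.RandomPlanarGeometry.SLERestrictionMartingaleKappaLimits
import Literature.Probability.RandomPlanarGeometry.SLERestrictionLemmasKappaAll
import Literature.Probability.RandomPlanarGeometry.SLEBubblesSchwarzianMass
import Literature.Probability.RandomPlanarGeometry.StarBubbleMassSign
import Literature.Probability.RandomPlanarGeometry.SLERestrictionSmoothProofs
import Literature.Probability.RandomPlanarGeometry.SmoothArcApproximation
import HarnessLib

/-!
# [LSW] Theorem 6.5 for every `A ∈ 𝒬*`, and the discharge of `SLEBubbles.lintegral_poissonAvoidance_eq_rpow`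

G. F. Lawler, O. Schramm, W. Werner, *Conformal restriction: the chordal case*, J. Amer. Math. Soc.
**16** (2003) 917–955 (**[LSW]**), §6 **Theorem 6.5**: "Suppose `0 ≤ κ ≤ 8/3` and let `α`, `λ` be
as in (5.2), (5.3). If `W_t = √κ B_t` and `A ∈ 𝒬*`, then
`Φ_A′(0)^α = E[1_{γ[0,∞) ∩ A = ∅} exp(λ ∫₀^∞ Sh_s(W_s)/6 ds)]`", with the remark "A similar proof to
that of Theorem 6.1, using Proposition 5.3". Assembled here for `0 < κ ≤ 8/3` from:

* the compensated restriction martingale of Prop. 5.3 (`exists_isRestrictionMartingaleK`,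
  `SLERestrictionMartingaleExistsKappa`, compensator `LpK κ A`), Lemma 6.2 along SLE_κ for every
  `A ∈ 𝒬*` (`sle_restrictionDeriv_frequently_gtK_of_isStarHull`) and the limit machinery of
  `SLERestrictionMartingaleKappaLimits`;
* for SMOOTH one-sided hulls, Lemma 6.3 (`IsSmoothHull.restrictionDerivVanishesAtHit_holds`): the
  printed case (`lintegral_thm65Fun_LpK_eq_of_isSmoothHull`);
* for general one-sided hulls, the smooth outer approximation of Lemma 2.1
  (`IsPlusHull.exists_antitone_isSmoothHull_holds`, `HasSmoothApprox`): the functional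
  `A ↦ 1_{γ ∩ A = ∅} e^{−λ ∫ m(A_s − W_s)}` DECREASES in the hull (the mass `m = −SΦ/6 ≥ 0` increases,
  [LSW] (5.1), `starBubbleMass_mono`), so `Φ_{A_n}′(0)^α ≤ E[…A…] ≤ Φ_A′(0)^α`
  (`lintegral_thm65Fun_LpK_eq_of_plus_or_minus`) — the upper bound being Lemma 6.2 alone;
* for two-sided hulls `A = A₊ ∪ A₋`, domination by the side parts: before `T_A` the martingale of `A`
  is at most those of `A₊`, `A₋` (`Φ′` decreases and the mass increases in the hull), and the latter
  vanish from their hitting times on because Thm. 6.5 holds for them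
  (`ae_frozen_zero_of_lintegral_thm65Fun_eq`) — so the frozen value of the former is `0`
  (`lintegral_thm65Fun_LpK_eq`).

Finally the `[0, ∞]`-valued identity is rewritten in the form consumed by §7.2
(`thm65_printed`: `∫⁻ 1{γ ∩ A = ∅} · 𝒫(λ_κ ∫₀^∞ m(A_t − W_t) dt) = Φ_A′(0)^{α_κ}`), and
**`SLEBubbles.lintegral_poissonAvoidance_eq_rpow_holds`** follows by
`SLEBubbles.lintegral_poissonAvoidance_eq_rpow_of_thm65` ((7.2) along the flow, `SLEBubblesSchwarzianMass`).

## References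

* [LSW] Thm. 6.5 (§6) and its proof; Lemma 2.1, Prop. 3.3; §7.2 (pp. 28–29). [LawlerSchrammWerner2003Restriction]
* S. Rohde, O. Schramm, *Basic properties of SLE* (2005). [RohdeSchramm2005]
-/

noncomputable section

open Set Filter Metric Function MeasureTheory
open _root_.Complex _root_.Topology
open Literature.Probability.Process (brownian preWienerMeasure)
open UpperHalfPlane (upperHalfPlaneSet)
open scoped NNReal ENNReal

namespace Literature.Probability.RandomPlanarGeometry

open Loewner PathOps

/-! ### Elementary conversions -/

/-- `𝒫(x) = ofReal (e^{−x})` (`poissonAvoidance` vs `compFactor`). [folklore] -/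
theorem poissonAvoidance_eq_ofReal_compFactor (x : ℝ≥0∞) : poissonAvoidance x = ENNReal.ofReal (compFactor x) := by
  by_cases hx : x = ∞
  · rw [hx, poissonAvoidance_top, compFactor_top, ENNReal.ofReal_zero]
  · rw [poissonAvoidance, if_neg hx, compFactor_of_ne_top hx]

/-- A monotone family over `ℝ≥0` has the same supremum along `ℕ`. [folklore] -/
theorem iSup_eq_iSup_nat_of_monotone {f : ℝ≥0 → ℝ≥0∞} (hf : Monotone f) : (⨆ t, f t) = ⨆ n : ℕ, f n := by
  refine le_antisymm (iSup_le fun t ↦ ?_) (iSup_le fun n ↦ le_iSup f _)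
  obtain ⟨n, hn⟩ := exists_nat_ge (t : ℝ)
  have htn : t ≤ (n : ℝ≥0) := by exact_mod_cast hn
  exact (hf htn).trans (le_iSup (fun n : ℕ ↦ f n) n)

/-- Nothing is ever hit in the empty set. [folklore] -/
theorem firstHit_empty' (γ : ℝ≥0 → ℂ) : firstHit γ ∅ = ⊤ := by
  unfold firstHit; simp

/-- Slid hulls are monotone in the hull. [folklore] -/
theorem Loewner.slidHull_mono' (W : ℝ≥0 → ℝ) {A A' : Set ℂ} (h : A ⊆ A') (t : ℝ≥0) : slidHull W A t ⊆ slidHull W A' t := by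
  intro w hw
  obtain ⟨a, ha, rfl⟩ := mem_slidHull_iff.1 hw
  exact mem_slidHull_iff.2 ⟨a, h ha, rfl⟩

/-! ### The compensator `LpK` versus the time integral of (7.2) -/

section Convert

variable {κ : ℝ≥0} {A : Set ℂ}

/-- **`⨆_t L_t = ∫⁻_{(0,∞)} 𝟙{alive} m(A_s − W_s) ds`** (monotone convergence). [folklore] -/
theorem iSup_LpK_eq (hA : IsStarHull A) (hne : A.Nonempty) (ω : ℝ≥0 → ℝ) :
    (⨆ t, LpK κ A t ω) = ∫⁻ s in Ioi (0 : ℝ), ENNReal.ofReal (MpK κ A s.toNNReal ω) := by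
  set F : ℝ → ℝ≥0∞ := fun s ↦ ENNReal.ofReal (MpK κ A s.toNNReal ω) with hF
  have hFm : Measurable F := ((measurable_MpK_path hA hne ω).comp measurable_real_toNNReal).ennreal_ofReal
  rw [iSup_eq_iSup_nat_of_monotone (LpK_mono ω)]
  have h1 : ∀ n : ℕ, LpK κ A n ω = ∫⁻ s, (Ioc (0 : ℝ) n).indicator F s := fun n ↦ (lintegral_indicator measurableSet_Ioc _).symm
  have h2 : ∫⁻ s in Ioi (0 : ℝ), F s = ∫⁻ s, (Ioi (0 : ℝ)).indicator F s := (lintegral_indicator measurableSet_Ioi _).symm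
  simp_rw [h1]
  rw [h2, ← lintegral_iSup (fun n ↦ hFm.indicator measurableSet_Ioc) ?_]
  · congr 1
    funext s
    apply le_antisymm
    · exact iSup_le fun n ↦ indicator_le_indicator_of_subset Ioc_subset_Ioi_self (fun _ ↦ bot_le) s
    · by_cases hs : s ∈ Ioi (0 : ℝ)
      · obtain ⟨n, hn⟩ := exists_nat_ge s
        have : s ∈ Ioc (0 : ℝ) n := ⟨hs, hn⟩
        rw [indicator_of_mem hs]
        exact le_iSup_of_le n (by rw [indicator_of_mem this])
      · rw [indicator_of_notMem hs]; exact bot_le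
  · intro m n hmn s
    exact indicator_le_indicator_of_subset (Ioc_subset_Ioc_right (by exact_mod_cast hmn)) (fun _ ↦ bot_le) s

/-- **On a path alive at all times, `∫₀^∞ m(A_t − W_t) dt` (w.r.t. `timeMeasure`) is `⨆_t L_t`.** [folklore] -/
theorem lintegral_timeMeasure_eq_iSup_LpK (hA : IsStarHull A) (hne : A.Nonempty) {ω : ℝ≥0 → ℝ}
    (hall : ∀ t, Disjoint (closedHull (drvK κ (brownianCPath ω)) t) A) :
    ∫⁻ t, ENNReal.ofReal (starBubbleMass (slidHull (sleDriving κ ω) A t)) ∂timeMeasure = ⨆ t, LpK κ A t ω := by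
  have hg : (fun t ↦ ENNReal.ofReal (starBubbleMass (slidHull (sleDriving κ ω) A t))) = fun t ↦ ENNReal.ofReal (MpK κ A t ω) := by
    funext t; rw [MpK, MFnK_of_alive (hall t), drvK_brownianCPath]
  have hm : Measurable fun t ↦ ENNReal.ofReal (MpK κ A t ω) := (measurable_MpK_path hA hne ω).ennreal_ofReal
  rw [hg, iSup_LpK_eq hA hne ω, timeMeasure, lintegral_map hm measurable_real_toNNReal, Measure.restrict_congr_set Ioi_ae_eq_Ici.symm]

/-- **A.s., the hulls of the SLE_κ chain (`κ ≤ 4`) miss `A` at time `t` iff `t` is before the hitting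
time of `A` by the trace.** [cite: LawlerSchrammWerner2003Restriction, §5 (T) and proofs of Thm. 6.1/6.5] -/
theorem ae_disjoint_closedHull_iff_lt_firstHit (hκ0 : 0 < κ) (hκ4 : κ ≤ 4) (hA : IsStarHull A) :
    ∀ᵐ ω ∂preWienerMeasure, ∀ t, Disjoint (closedHull (drvK κ (brownianCPath ω)) t) A ↔
      (t : WithTop ℝ≥0) < firstHit (sleTrace κ ω) A := by
  obtain ⟨hgen, hsimple, -⟩ := sle_trace_facts_of_le_four hκ0 hκ4
  filter_upwards [ae_isGeneratedByCurve_sleTrace hgen, hsimple] with ω hg hs t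
  rw [drvK_brownianCPath]
  exact disjoint_closedHull_iff_lt_firstHit (continuous_sleDriving _ ω) (sleDriving_zero _ ω) hg hs hA t

/-- **The integrand of §7.2 is `thm65Fun κ λ A (LpK κ A)` almost surely** (`𝒫 = ofReal ∘ compFactor`,
`λ_κ = ofReal λ`, the time integral is `⨆_t L_t` on `{γ ∩ A = ∅}`).
[cite: LawlerSchrammWerner2003Restriction, Thm. 6.5 (§6) with §7.2 (pp. 28–29)] -/
theorem indicator_poissonAvoidance_ae_eq_thm65Fun (hκ0 : 0 < κ) (hκ4 : κ ≤ 4) (hA : IsStarHull A) (hne : A.Nonempty) (lam : ℝ) :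
    (fun ω ↦ {ω | Disjoint (range (sleTrace κ ω)) A}.indicator
        (fun ω ↦ poissonAvoidance (ENNReal.ofReal lam *
          ∫⁻ t, ENNReal.ofReal (starBubbleMass (slidHull (sleDriving κ ω) A t)) ∂timeMeasure)) ω) =ᵐ[preWienerMeasure]
      thm65Fun κ lam A (LpK κ A) := by
  filter_upwards [ae_disjoint_closedHull_iff_lt_firstHit hκ0 hκ4 hA] with ω hω
  by_cases hT : firstHit (sleTrace κ ω) A = ⊤
  · have hdisj : Disjoint (range (sleTrace κ ω)) A := firstHit_eq_top_iff_disjoint.1 hT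
    have hall : ∀ t, Disjoint (closedHull (drvK κ (brownianCPath ω)) t) A := fun t ↦
      (hω t).2 (by rw [hT]; exact WithTop.coe_lt_top t)
    rw [indicator_of_mem (show ω ∈ {ω | Disjoint (range (sleTrace κ ω)) A} from hdisj), thm65Fun_of_eq_top hT,
      poissonAvoidance_eq_ofReal_compFactor, lintegral_timeMeasure_eq_iSup_LpK hA hne hall]
  · have hndisj : ¬ Disjoint (range (sleTrace κ ω)) A := fun h ↦ hT (firstHit_eq_top_iff_disjoint.2 h)
    rw [indicator_of_notMem (show ω ∉ {ω | Disjoint (range (sleTrace κ ω)) A} from hndisj), thm65Fun_of_ne_top hT]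

/-! ### Monotonicity in the hull -/

/-- The mass increases with the hull (while the larger hull is alive). [cite: LawlerSchrammWerner2003Restriction, (5.1)] -/
theorem MpK_le_of_subset {A' : Set ℂ} (hA : IsStarHull A) (hA' : IsStarHull A') (hsub : A ⊆ A') {s : ℝ≥0} {ω : ℝ≥0 → ℝ}
    (halive' : Disjoint (closedHull (drvK κ (brownianCPath ω)) s) A') : MpK κ A s ω ≤ MpK κ A' s ω := by
  have halive : Disjoint (closedHull (drvK κ (brownianCPath ω)) s) A := halive'.mono_right hsub
  rw [MpK, MpK, MFnK_of_alive halive, MFnK_of_alive halive']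
  exact starBubbleMass_mono (Loewner.isStarHull_slidHull_of_disjoint (continuous_drvK κ _) hA halive)
    (Loewner.isStarHull_slidHull_of_disjoint (continuous_drvK κ _) hA' halive') (Loewner.slidHull_mono' _ hsub s)

/-- The compensator increases with the hull (while the larger hull is alive). [folklore] -/
theorem LpK_le_of_subset {A' : Set ℂ} (hA : IsStarHull A) (hA' : IsStarHull A') (hsub : A ⊆ A') {t : ℝ≥0} {ω : ℝ≥0 → ℝ}
    (halive' : ∀ s, s ≤ t → Disjoint (closedHull (drvK κ (brownianCPath ω)) s) A') : LpK κ A t ω ≤ LpK κ A' t ω := by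
  refine lintegral_mono_ae ?_
  filter_upwards [ae_restrict_mem measurableSet_Ioc] with s hs
  exact ENNReal.ofReal_le_ofReal (MpK_le_of_subset hA hA' hsub (halive' _ (Real.toNNReal_le_iff_le_coe.2 hs.2)))

/-- **The integrand of Thm. 6.5 DECREASES with the hull** (`λ ≥ 0`): for `*`-hulls `A ⊆ A'`, a.s.
`1_{γ ∩ A' = ∅} e^{−λ ∫ m(A′)} ≤ 1_{γ ∩ A = ∅} e^{−λ ∫ m(A)}`. [cite: LawlerSchrammWerner2003Restriction, (5.1) and Thm. 6.5] -/
theorem thm65Fun_LpK_anti (hκ0 : 0 < κ) (hκ4 : κ ≤ 4) {A' : Set ℂ} (hA : IsStarHull A) (hA' : IsStarHull A')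
    (hsub : A ⊆ A') {lam : ℝ} :
    ∀ᵐ ω ∂preWienerMeasure, thm65Fun κ lam A' (LpK κ A') ω ≤ thm65Fun κ lam A (LpK κ A) ω := by
  filter_upwards [ae_disjoint_closedHull_iff_lt_firstHit hκ0 hκ4 hA'] with ω hω'
  by_cases hT' : firstHit (sleTrace κ ω) A' = ⊤
  · have hT : firstHit (sleTrace κ ω) A = ⊤ := eq_top_iff.2 (hT' ▸ firstHit_mono _ hsub)
    have hall' : ∀ s, Disjoint (closedHull (drvK κ (brownianCPath ω)) s) A' := fun s ↦
      (hω' s).2 (by rw [hT']; exact WithTop.coe_lt_top s)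
    rw [thm65Fun_of_eq_top hT', thm65Fun_of_eq_top hT]
    refine ENNReal.ofReal_le_ofReal (compFactor_antitone ?_)
    gcongr with t
    exact LpK_le_of_subset hA hA' hsub fun s _ ↦ hall' s
  · rw [thm65Fun_of_ne_top hT']; exact bot_le

end Convert

/-! ### Theorem 6.5 in `[0, ∞]`-valued form, hull by hull -/

section Thm65

variable {κ : ℝ≥0} {α lam : ℝ} (hκ0 : 0 < κ) (hκ : κ ≤ 8 / 3) (hαdef : α = (6 - κ) / (2 * κ))
  (hlamdef : lam = (8 - 3 * κ) * (6 - κ) / (2 * κ)) {A : Set ℂ}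

include hκ in
/-- `κ ≤ 8/3` implies `κ ≤ 4`. [folklore] -/
theorem le_four_of_le_eight_thirds : κ ≤ 4 := hκ.trans (by rw [div_le_iff₀ (by norm_num : (0 : ℝ≥0) < 3)]; norm_num)

include hκ0 hκ hαdef hlamdef in
/-- **The upper bound of Thm. 6.5 for every `A ∈ 𝒬*`** (Lemma 6.2 alone).
[cite: LawlerSchrammWerner2003Restriction, proof of Thm. 6.5 (§6)] -/
theorem lintegral_thm65Fun_LpK_le (hA : IsStarHull A) {Φ : ConformalEquiv (upperHalfPlaneSet \ A) upperHalfPlaneSet}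
    (hΦ : IsRestrictionMap A Φ) {d : ℝ} (hd : HasRestrictionDeriv A Φ d) :
    ∫⁻ ω, thm65Fun κ lam A (LpK κ A) ω ∂preWienerMeasure ≤ ENNReal.ofReal (d ^ α) := by
  obtain ⟨hαpos, -⟩ := exponents_pos hκ hαdef hlamdef hκ0
  obtain ⟨Y, hY⟩ := exists_isRestrictionMartingaleK hκ0 hκ hαdef hlamdef hA
  exact hY.lintegral_thm65Fun_le hαpos IsStarHull.existsUnique_isRestrictionMap_holds hA hΦ hd
    (sle_restrictionDeriv_frequently_gtK_of_isStarHull hκ0 (le_four_of_le_eight_thirds hκ) hA)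

include hκ0 hκ hαdef hlamdef in
/-- **Thm. 6.5 for a SMOOTH `*`-hull** (the printed case: Lemmas 6.2 and 6.3).
[cite: LawlerSchrammWerner2003Restriction, Thm. 6.5 and its proof (§6)] -/
theorem lintegral_thm65Fun_LpK_eq_of_isSmoothHull (hsm : IsSmoothHull A) (hA : IsStarHull A)
    {Φ : ConformalEquiv (upperHalfPlaneSet \ A) upperHalfPlaneSet} (hΦ : IsRestrictionMap A Φ) {d : ℝ} (hd : HasRestrictionDeriv A Φ d) :
    ∫⁻ ω, thm65Fun κ lam A (LpK κ A) ω ∂preWienerMeasure = ENNReal.ofReal (d ^ α) := by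
  obtain ⟨hαpos, -⟩ := exponents_pos hκ hαdef hlamdef hκ0
  have hκ4 := le_four_of_le_eight_thirds hκ
  obtain ⟨Y, hY⟩ := exists_isRestrictionMartingaleK hκ0 hκ hαdef hlamdef hA
  exact hY.lintegral_thm65Fun_eq_of_ltK hαpos IsStarHull.existsUnique_isRestrictionMap_holds hA hΦ hd
    (sle_restrictionDeriv_frequently_gtK_of_isStarHull hκ0 hκ4 hA)
    (sle_restrictionDeriv_frequently_ltK_of_vanishesAtHit hκ0 hκ4 hA (IsSmoothHull.restrictionDerivVanishesAtHit_holds hsm hA))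

/-- **Thm. 6.5 for the empty hull** (`T = ∞`, `m = 0`, `Φ_∅ = id`). [folklore] -/
theorem lintegral_thm65Fun_LpK_empty (κ : ℝ≥0) (α lam : ℝ) {Φ : ConformalEquiv (upperHalfPlaneSet \ (∅ : Set ℂ)) upperHalfPlaneSet}
    (hΦ : IsRestrictionMap ∅ Φ) {d : ℝ} (hd : HasRestrictionDeriv ∅ Φ d) :
    ∫⁻ ω, thm65Fun κ lam (∅ : Set ℂ) (LpK κ ∅) ω ∂preWienerMeasure = ENNReal.ofReal (d ^ α) := by
  haveI := isProbabilityMeasure_preWienerMeasure'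
  have hd1 : d = 1 := HasRestrictionDeriv.eq_of_isRestrictionMap IsStarHull.existsUnique_isRestrictionMap_holds
    isStarHull_empty isRestrictionMap_empty hΦ hasRestrictionDeriv_empty hd
  have h1 : ∀ ω, thm65Fun κ lam (∅ : Set ℂ) (LpK κ ∅) ω = 1 := fun ω ↦ by
    rw [thm65Fun_of_eq_top (firstHit_empty' _), LpK_empty]
    simp
  simp_rw [h1, hd1, Real.one_rpow, ENNReal.ofReal_one, lintegral_const, one_mul, measure_univ]

include hκ0 hκ hαdef hlamdef in
/-- **Thm. 6.5 for every one-sided `A ∈ 𝒬₊ ∪ 𝒬₋`**: the upper bound is Lemma 6.2; the lower bound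
comes from the smooth outer approximations `A ⊆ A_n` of Lemma 2.1 (`HasSmoothApprox`), for which
Thm. 6.5 holds and whose integrands are smaller (`thm65Fun_LpK_anti`), with `Φ_{A_n}′(0) → Φ_A′(0)`.
[cite: LawlerSchrammWerner2003Restriction, Thm. 6.5 (§6) with Lemma 2.1 and Prop. 3.3] -/
theorem lintegral_thm65Fun_LpK_eq_of_plus_or_minus (hpm : IsPlusHull A ∨ IsMinusHull A)
    {Φ : ConformalEquiv (upperHalfPlaneSet \ A) upperHalfPlaneSet} (hΦ : IsRestrictionMap A Φ) {d : ℝ} (hd : HasRestrictionDeriv A Φ d) :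
    ∫⁻ ω, thm65Fun κ lam A (LpK κ A) ω ∂preWienerMeasure = ENNReal.ofReal (d ^ α) := by
  obtain ⟨hαpos, -⟩ := exponents_pos hκ hαdef hlamdef hκ0
  have hκ4 := le_four_of_le_eight_thirds hκ
  have hA : IsStarHull A := hpm.elim (fun h ↦ h.1) (fun h ↦ h.1)
  rcases A.eq_empty_or_nonempty with rfl | hne
  · exact lintegral_thm65Fun_LpK_empty κ α lam hΦ hd
  refine le_antisymm (lintegral_thm65Fun_LpK_le hκ0 hκ hαdef hlamdef hA hΦ hd) ?_
  obtain ⟨J, F, hJs, hJpm, hJm, hJi, hAF, -, -, hconv⟩ :=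
    hasSmoothApprox_of_plus_or_minus IsPlusHull.exists_antitone_isSmoothHull_holds hpm hne
  have hJst : ∀ n, IsStarHull (J n) := fun n ↦ (hJpm n).elim (fun h ↦ h.1) (fun h ↦ h.1)
  have hdata : ∀ n, ∃ (Ψ : ConformalEquiv (upperHalfPlaneSet \ J n) upperHalfPlaneSet) (e : ℝ),
      IsRestrictionMap (J n) Ψ ∧ HasRestrictionDeriv (J n) Ψ e := fun n ↦ by
    obtain ⟨Ψ, hΨ, -⟩ := IsStarHull.existsUnique_isRestrictionMap_holds (hJst n)
    obtain ⟨e, -, -, he⟩ := IsStarHull.exists_hasRestrictionDeriv_holds (hJst n) hΨ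
    exact ⟨Ψ, e, hΨ, he⟩
  choose Ψ dn hΨ hdn using hdata
  have hlim : Tendsto dn atTop (𝓝 d) := hconv Φ Ψ d dn hΦ hd hΨ hdn
  have hAJ : ∀ n, A ⊆ J n := fun n ↦ hAF.trans (hJi ▸ iInter_subset J n)
  have hle : ∀ n, ENNReal.ofReal (dn n ^ α) ≤ ∫⁻ ω, thm65Fun κ lam A (LpK κ A) ω ∂preWienerMeasure := fun n ↦ by
    rw [← lintegral_thm65Fun_LpK_eq_of_isSmoothHull hκ0 hκ hαdef hlamdef (hJs n) (hJst n) (hΨ n) (hdn n)]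
    exact lintegral_mono_ae (thm65Fun_LpK_anti hκ0 hκ4 hA (hJst n) (hAJ n))
  have htend : Tendsto (fun n ↦ ENNReal.ofReal (dn n ^ α)) atTop (𝓝 (ENNReal.ofReal (d ^ α))) :=
    ENNReal.tendsto_ofReal (hlim.rpow_const (Or.inr hαpos.le))
  exact le_of_tendsto' htend hle

include hκ0 hκ hαdef hlamdef in
/-- **Domination by the side parts**: for `A = A₊ ∪ A₋ ∈ 𝒬*` with martingales `Y, Y₊, Y₋`
(compensators `LpK`), if `Y₊`, `Y₋` vanish from their hitting times on, then so does `Y`: before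
`T_A` one has `Y ≤ Y₊` and `Y ≤ Y₋` (`Φ′` decreases, the mass increases with the hull), and `T_A` is
the hitting time of one of the parts. [folklore] -/
theorem ae_frozen_zero_of_sideParts (hA : IsStarHull A) {Ap Am : Set ℂ} (hunion : Ap ∪ Am = A)
    (hAp : IsStarHull Ap) (hAm : IsStarHull Am) {Y Yp Ym : ℝ≥0 → (ℝ≥0 → ℝ) → ℝ}
    (hY : IsRestrictionMartingaleK κ α lam A (LpK κ A) Y) (hYp : IsRestrictionMartingaleK κ α lam Ap (LpK κ Ap) Yp)
    (hYm : IsRestrictionMartingaleK κ α lam Am (LpK κ Am) Ym)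
    (hp0 : ∀ᵐ ω ∂preWienerMeasure, ∀ τ : ℝ≥0, firstHit (sleTrace κ ω) Ap = τ → ∀ t : ℝ≥0, τ ≤ t → Yp t ω = 0)
    (hm0 : ∀ᵐ ω ∂preWienerMeasure, ∀ τ : ℝ≥0, firstHit (sleTrace κ ω) Am = τ → ∀ t : ℝ≥0, τ ≤ t → Ym t ω = 0) :
    ∀ᵐ ω ∂preWienerMeasure, ∀ τ : ℝ≥0, firstHit (sleTrace κ ω) A = τ → ∀ t : ℝ≥0, τ ≤ t → Y t ω = 0 := by
  obtain ⟨hαpos, hlam0⟩ := exponents_pos hκ hαdef hlamdef hκ0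
  have hκ4 := le_four_of_le_eight_thirds hκ
  have huniq : IsStarHull.existsUnique_isRestrictionMap := IsStarHull.existsUnique_isRestrictionMap_holds
  have hsubp : Ap ⊆ A := hunion ▸ subset_union_left
  have hsubm : Am ⊆ A := hunion ▸ subset_union_right
  -- domination of `Y` by the martingale of a part, abstractly
  have dom : ∀ {B : Set ℂ} {Z : ℝ≥0 → (ℝ≥0 → ℝ) → ℝ}, IsStarHull B → B ⊆ A →
      IsRestrictionMartingaleK κ α lam B (LpK κ B) Z →
      ∀ᵐ ω ∂preWienerMeasure, ∀ s : ℝ≥0, (s : WithTop ℝ≥0) < firstHit (sleTrace κ ω) A → Y s ω ≤ Z s ω := by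
    intro B Z hB hBA hZ
    filter_upwards [hY.ae_exists_eq, hZ.ae_exists_eq, ae_disjoint_closedHull_iff_lt_firstHit hκ0 hκ4 hA] with ω hrA hrB hidA s hs
    have hsB : (s : WithTop ℝ≥0) < firstHit (sleTrace κ ω) B := hs.trans_le (firstHit_mono _ hBA)
    obtain ⟨ΨA, eA, hΨA, heA, heA0, -, hYs⟩ := hrA s hs
    obtain ⟨ΨB, eB, hΨB, heB, -, heB1, hZs⟩ := hrB s hsB
    have haliveA : ∀ r, r ≤ s → Disjoint (closedHull (drvK κ (brownianCPath ω)) r) A := fun r hr ↦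
      (hidA r).2 (lt_of_le_of_lt (WithTop.coe_le_coe.2 hr) hs)
    have hW : drvK κ (brownianCPath ω) = sleDriving κ ω := drvK_brownianCPath κ ω
    have hBA_s : IsStarHull (slidHull (sleDriving κ ω) A s) := by
      rw [← hW]; exact Loewner.isStarHull_slidHull_of_disjoint (continuous_drvK κ _) hA (haliveA s le_rfl)
    have hBB_s : IsStarHull (slidHull (sleDriving κ ω) B s) := by
      rw [← hW]; exact Loewner.isStarHull_slidHull_of_disjoint (continuous_drvK κ _) hB ((haliveA s le_rfl).mono_right hBA)
    have he : eA ≤ eB := HasRestrictionDeriv.le_of_subset hBA_s hBB_s (Loewner.slidHull_mono' _ hBA s) hΨA hΨB heA heB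
    have hL : LpK κ B s ω ≤ LpK κ A s ω := LpK_le_of_subset hB hA hBA haliveA
    rw [hYs, hZs]
    have h1 : eA ^ α ≤ eB ^ α := Real.rpow_le_rpow heA0.le he hαpos.le
    have h2 : compFactor (ENNReal.ofReal lam * LpK κ A s ω) ≤ compFactor (ENNReal.ofReal lam * LpK κ B s ω) :=
      compFactor_antitone (by gcongr)
    exact mul_le_mul h1 h2 (compFactor_mem_Icc _).1 (Real.rpow_nonneg (heA0.le.trans he) _)
  filter_upwards [dom hAp hsubp hYp, dom hAm hsubm hYm, hY.ae_frozen, hYp.ae_frozen, hYm.ae_frozen, hp0, hm0]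
    with ω hdp hdm hfY hfP hfM h0p h0m τ hτ t hτt
  have hτ0 : 0 < τ := by
    have h := firstHit_sleTrace_pos κ hA.isBoundedHull.isClosed hA.zero_notMem ω
    rw [hτ] at h
    exact_mod_cast h
  haveI : (𝓝[<] τ).NeBot := nhdsLT_neBot_of_exists_lt ⟨0, hτ0⟩
  have hmin : min (firstHit (sleTrace κ ω) Ap) (firstHit (sleTrace κ ω) Am) = τ := by
    rw [← firstHit_union, hunion]; exact hτ
  have hY0 : 0 ≤ Y t ω := (hY.mem_Icc t ω).1
  have hlimY : Tendsto (fun s ↦ Y s ω) (𝓝[<] τ) (𝓝 (Y t ω)) := hfY τ hτ t hτt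
  have hbefore : ∀ᶠ s : ℝ≥0 in 𝓝[<] τ, (s : WithTop ℝ≥0) < firstHit (sleTrace κ ω) A := by
    filter_upwards [self_mem_nhdsWithin] with s hs
    rw [hτ]; exact_mod_cast hs
  -- the part that is hit at `τ`
  rcases min_eq_iff.1 hmin with ⟨hτp, -⟩ | ⟨hτm, -⟩
  · have hlimP : Tendsto (fun s ↦ Yp s ω) (𝓝[<] τ) (𝓝 0) := by
      have := hfP τ hτp τ le_rfl
      rwa [h0p τ hτp τ le_rfl] at this
    have hle : Y t ω ≤ 0 := le_of_tendsto_of_tendsto hlimY hlimP (hbefore.mono fun s hs ↦ hdp s hs)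
    linarith
  · have hlimM : Tendsto (fun s ↦ Ym s ω) (𝓝[<] τ) (𝓝 0) := by
      have := hfM τ hτm τ le_rfl
      rwa [h0m τ hτm τ le_rfl] at this
    have hle : Y t ω ≤ 0 := le_of_tendsto_of_tendsto hlimY hlimM (hbefore.mono fun s hs ↦ hdm s hs)
    linarith

include hκ0 hκ hαdef hlamdef in
/-- **[LSW] Theorem 6.5 for EVERY `A ∈ 𝒬*`, in `[0, ∞]`-valued form**:
`∫⁻ 1_{γ ∩ A = ∅} e^{−λ ⨆_t L_t} = Φ_A′(0)^α` for the compensator `L = LpK κ A`.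
[cite: LawlerSchrammWerner2003Restriction, Thm. 6.5 (§6)] -/
theorem lintegral_thm65Fun_LpK_eq (hA : IsStarHull A)
    {Φ : ConformalEquiv (upperHalfPlaneSet \ A) upperHalfPlaneSet} (hΦ : IsRestrictionMap A Φ) {d : ℝ} (hd : HasRestrictionDeriv A Φ d) :
    ∫⁻ ω, thm65Fun κ lam A (LpK κ A) ω ∂preWienerMeasure = ENNReal.ofReal (d ^ α) := by
  obtain ⟨hαpos, -⟩ := exponents_pos hκ hαdef hlamdef hκ0
  have hκ4 := le_four_of_le_eight_thirds hκ
  have huniq : IsStarHull.existsUnique_isRestrictionMap := IsStarHull.existsUnique_isRestrictionMap_holds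
  -- the side parts
  have hnf := hA.isBoundedHull.isConnected_union_im_nonpos
  obtain ⟨hP, hMi, hunion, -, -, -⟩ := hA.sidePart_decomposition hnf
  rcases (sidePart A (-1)).eq_empty_or_nonempty with hm0 | -
  · have hAeq : sidePart A 1 = A := by
      conv_rhs => rw [← hunion, hm0, union_empty]
    rw [hAeq] at hP
    exact lintegral_thm65Fun_LpK_eq_of_plus_or_minus hκ0 hκ hαdef hlamdef (Or.inl hP) hΦ hd
  rcases (sidePart A 1).eq_empty_or_nonempty with hp0 | -
  · have hAeq : sidePart A (-1) = A := by
      conv_rhs => rw [← hunion, hp0, empty_union]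
    rw [hAeq] at hMi
    exact lintegral_thm65Fun_LpK_eq_of_plus_or_minus hκ0 hκ hαdef hlamdef (Or.inr hMi) hΦ hd
  -- two-sided: martingales of `A` and its parts, Thm. 6.5 for the parts
  obtain ⟨Y, hY⟩ := exists_isRestrictionMartingaleK hκ0 hκ hαdef hlamdef hA
  obtain ⟨Yp, hYp⟩ := exists_isRestrictionMartingaleK hκ0 hκ hαdef hlamdef hP.1
  obtain ⟨Ym, hYm⟩ := exists_isRestrictionMartingaleK hκ0 hκ hαdef hlamdef hMi.1
  obtain ⟨Φp, hΦp, -⟩ := huniq hP.1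
  obtain ⟨dp, -, -, hdp⟩ := IsStarHull.exists_hasRestrictionDeriv_holds hP.1 hΦp
  obtain ⟨Φm, hΦm, -⟩ := huniq hMi.1
  obtain ⟨dm, -, -, hdm⟩ := IsStarHull.exists_hasRestrictionDeriv_holds hMi.1 hΦm
  have h62 := sle_restrictionDeriv_frequently_gtK_of_isStarHull hκ0 hκ4 hA
  have hp0 := hYp.ae_frozen_zero_of_lintegral_thm65Fun_eq hαpos huniq hP.1 hΦp hdp
    (sle_restrictionDeriv_frequently_gtK_of_isStarHull hκ0 hκ4 hP.1)
    (lintegral_thm65Fun_LpK_eq_of_plus_or_minus hκ0 hκ hαdef hlamdef (Or.inl hP) hΦp hdp)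
  have hm0 := hYm.ae_frozen_zero_of_lintegral_thm65Fun_eq hαpos huniq hMi.1 hΦm hdm
    (sle_restrictionDeriv_frequently_gtK_of_isStarHull hκ0 hκ4 hMi.1)
    (lintegral_thm65Fun_LpK_eq_of_plus_or_minus hκ0 hκ hαdef hlamdef (Or.inr hMi) hΦm hdm)
  exact hY.lintegral_thm65Fun_eq_of_frozen_zero hαpos huniq hA hΦ hd h62
    (ae_frozen_zero_of_sideParts hκ0 hκ hαdef hlamdef hA hunion hP.1 hMi.1 hY hYp hYm hp0 hm0)

end Thm65

/-! ### Theorem 6.5 as consumed by §7.2, and the discharge -/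

/-- **[LSW] Theorem 6.5, read through (7.2)**: for `0 < κ ≤ 8/3`, `A ∈ 𝒬*` with restriction data
`(Φ, d)`, `∫⁻ 1{γ[0,∞) ∩ A = ∅} · 𝒫(λ_κ ∫₀^∞ m(A_t − W_t) dt) = Φ_A′(0)^{α_κ}`
(`m = starBubbleMass = −SΦ/6`, `𝒫(x) = e^{−x}`, `e^{−∞} = 0`).
[cite: LawlerSchrammWerner2003Restriction, Thm. 6.5 (§6) with §7.2 (pp. 28–29, proof of (7.3))] -/
theorem thm65_printed {κ : ℝ≥0} (hκ0 : 0 < κ) (hκ : κ ≤ 8 / 3) {A : Set ℂ} (hA : IsStarHull A)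
    {Φ : ConformalEquiv (upperHalfPlaneSet \ A) upperHalfPlaneSet} (hΦ : IsRestrictionMap A Φ)
    {d : ℝ} (hd : HasRestrictionDeriv A Φ d) :
    ∫⁻ ω, {ω | Disjoint (range (sleTrace κ ω)) A}.indicator
        (fun ω ↦ poissonAvoidance (sleBubbleIntensity κ *
          ∫⁻ t, ENNReal.ofReal (starBubbleMass (slidHull (sleDriving κ ω) A t)) ∂timeMeasure)) ω ∂preWienerMeasure =
      ENNReal.ofReal (d ^ sleBubbleExponent κ) := by
  have hκ4 : κ ≤ 4 := le_four_of_le_eight_thirds hκ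
  rcases A.eq_empty_or_nonempty with rfl | hne
  · -- the empty hull
    haveI := isProbabilityMeasure_preWienerMeasure'
    have hd1 : d = 1 := HasRestrictionDeriv.eq_of_isRestrictionMap IsStarHull.existsUnique_isRestrictionMap_holds
      isStarHull_empty isRestrictionMap_empty hΦ hasRestrictionDeriv_empty hd
    have h1 : ∀ ω : ℝ≥0 → ℝ, {ω : ℝ≥0 → ℝ | Disjoint (range (sleTrace κ ω)) ∅}.indicator
        (fun ω ↦ poissonAvoidance (sleBubbleIntensity κ *
          ∫⁻ t, ENNReal.ofReal (starBubbleMass (slidHull (sleDriving κ ω) ∅ t)) ∂timeMeasure)) ω = 1 := fun ω ↦ by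
      rw [indicator_of_mem (show ω ∈ {ω : ℝ≥0 → ℝ | Disjoint (range (sleTrace κ ω)) ∅} from disjoint_empty _)]
      simp [Loewner.slidHull_empty, starBubbleMass_empty]
    simp_rw [h1, hd1, Real.one_rpow, ENNReal.ofReal_one, lintegral_const, one_mul, measure_univ]
  rw [sleBubbleIntensity, lintegral_congr_ae (indicator_poissonAvoidance_ae_eq_thm65Fun hκ0 hκ4 hA hne (sleBubbleIntensityReal κ))]
  exact lintegral_thm65Fun_LpK_eq hκ0 hκ rfl rfl hA hΦ hd

/-- **DISCHARGE of `SLEBubbles.lintegral_poissonAvoidance_eq_rpow`** — [LSW] Theorem 6.5 read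
through (7.2), for every `0 < κ ≤ 8/3`, every Brownian bubble measure and every `A ∈ 𝒬*`: by
`SLEBubbles.lintegral_poissonAvoidance_eq_rpow_of_thm65` ((7.2) along the SLE flow) from
`thm65_printed`. [cite: LawlerSchrammWerner2003Restriction, Thm. 6.5 (§6) with §7.2 (pp. 28–29, proof of (7.3))] -/
theorem SLEBubbles.lintegral_poissonAvoidance_eq_rpow_holds : SLEBubbles.lintegral_poissonAvoidance_eq_rpow :=
  SLEBubbles.lintegral_poissonAvoidance_eq_rpow_of_thm65 fun hκ0 hκ _ hA _ hΦ _ hd ↦ thm65_printed hκ0 hκ hA hΦ hd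

end Literature.Probability.RandomPlanarGeometry

end
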